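import Summits.CriticalPhenomena.CardyFormulaZ2.Theorems.CardyUniqueLimitCardyRigiditySlitCrossingTransfer
import Summits.CriticalPhenomena.CardyFormulaZ2.Theorems.CardyUniqueLimitCardyRigiditySlitCrossingEventIdentity
import HarnessLib

/-!
# Transfer of inner flower crossings into the slit structure (the lower half of the sandwich)

Crux `Summit.CriticalPhenomena.CardyFormulaZ2.Theses.CardyUniqueLimit.CardyRigidity`
(stmt-CriticalPhenomena-0746), line `crossing_martingale`, stub `stub_slitObservableApprox`,
piece (P-approx)(iii), (H6)-inner (worker A3b of lead c2; rc 0, UNLANDED).  The SLIT-STRUCTURE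
version of the landed transfer lemma `slitCrossing_discreteCrossing_subset_of_margins`
(…SlitCrossingTransfer.lean): if an inner flower domain `(R₁; A₁, B₁)` sits in flower position
inside the discrete domain `Ω_δ` of admissible Dobrushin data — petals poking out of `Ω` near the
reference boundary pieces `A` (source) and `B` (target), otherwise away from `∂Ω`, from the
`B`-arc sites, and from the REVEALED EDGES of the exploration prefix — then every open crossing
of `(R₁)_δ` from the discrete arc of `A₁` to that of `B₁` contains a SLIT CROSSING
(`EventIdentity.slitCrossing`: free, unrevealed open edges of `Ω_δ`) from `X₁ ⊇` (arc-`A` sites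
near `A`) to `X₂ ⊇` (arc-`A` sites near `B`) or to the left bank:

* `SlitTransfer.slitCrossing_of_discreteCrossing` — the transfer (abstract walk invariant
  `Transfer.exists_reachable_of_walk` with target graph the slit graph; breaks are the breaks of
  the domain transfer (`Transfer.break_type`, `Transfer.mem_discreteArc_of_break`) plus wired
  `A`–`A` edges, which join two arc-`A` sites inside the flower, hence inside the petal zones).

This is the inner (lower) half of the sandwich for the slit 4-gon with BOTH petals outside the
domain (across `(u₂,u₁)` and across `(u₀, O⁻)`): it needs no information on the hull beyond
"the flower avoids the revealed edges" (uniform closeness of the discrete prefix to the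
continuum hull), in particular neither hull-boundary convergence nor fatness.
-/

noncomputable section

open Set Metric
open Literature.Probability Literature.Probability.LatticeModels Literature.Probability.Percolation
open Literature.Probability.LatticeModels.DiscreteDobrushin
open Summit.CriticalPhenomena.CardyFormulaZ2.Cruxes.ParafermionToSLESixFamilies.CaratheodoryNetSlitUniformity
  (revealedFreeEdges)

namespace Summit.CriticalPhenomena.CardyFormulaZ2.Cruxes.CardyRigidity.CrossingMartingale

namespace SlitTransfer

open Transfer EventIdentity

variable {D : DiscreteDobrushin} (hD : D.IsZdAdmissible)

/-- **Inner flower crossings are slit crossings.**  Let `D` be admissible Dobrushin data with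
domain `Ω`, mesh `δ`, an exploration prefix (`ω₀`, depth `n`), reference boundary pieces `A`
(source) and `B` (target) and site sets `X₁ ⊇ {arc-A sites within m of A}`,
`X₂ ⊇ {arc-A sites within m of B}`, `X₁ ⊆ Ω_δ`.  Let `(R₁; A₁, B₁)` be open in flower position
against `(Ω; A, B)` at margin `m > δ` ((H1)–(H6) of the domain transfer lemma), and assume
moreover that no arc-`B` site, and no endpoint of a revealed free edge of the prefix, has its
mesh point in `R₁`, and that arc-`A` sites with mesh point in `R₁` are `A`- or `B`-close.  Then
`discreteCrossing R₁ δ A₁ B₁ ⊆ slitCrossing hD X₁ X₂ ω₀ n`. [cite: CamiaNewman2007, Thm 3 and Lemma 7.3] -/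
theorem slitCrossing_of_discreteCrossing (ω₀ : BondConfig (Site 2)) (n : ℕ) (X₁ X₂ : Set (Site 2))
    (R₁ A₁ B₁ A B : Set ℂ) (m : ℝ) (hR₁ : IsOpen R₁) (hΩ : IsOpen D.Ω) (hδm : D.δ < m)
    (H1 : ∀ z ∈ R₁, infDist z A₁ ≤ D.δ → infDist z A < m ∧ z ∉ D.Ω)
    (H2 : ∀ z ∈ R₁, infDist z B₁ ≤ D.δ → infDist z B < m ∧ z ∉ D.Ω)
    (H3 : ∀ z, infDist z A < m → m + D.δ ≤ infDist z B)
    (H4 : ∀ f ∈ closure R₁ ∩ frontier D.Ω, (f ∈ A ∧ 2 * D.δ ≤ infDist f (frontier D.Ω \ A)) ∨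
      (f ∈ B ∧ 2 * D.δ ≤ infDist f (frontier D.Ω \ B)))
    (H5 : ∀ z ∈ R₁, z ∉ D.Ω → infDist z A < m ∨ infDist z B < m)
    (H6 : ∀ v : Site 2, meshPoint D.δ v ∈ R₁ → meshPoint D.δ v ∈ D.Ω → v ∉ meshDomain D.Ω D.δ →
      infDist (meshPoint D.δ v) A < m ∨ infDist (meshPoint D.δ v) B < m)
    (HB : ∀ v ∈ D.zdArcB, meshPoint D.δ v ∉ R₁)
    (HA : ∀ v ∈ D.zdArcA, meshPoint D.δ v ∈ R₁ →
      infDist (meshPoint D.δ v) A < m ∨ infDist (meshPoint D.δ v) B < m)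
    (HR : ∀ e ∈ revealedFreeEdges hD ω₀ n, ∀ v ∈ e, meshPoint D.δ v ∉ R₁)
    (hX₁ : ∀ v ∈ D.zdArcA, infDist (meshPoint D.δ v) A < m → v ∈ X₁)
    (hX₁M : X₁ ⊆ meshDomain D.Ω D.δ)
    (hX₂ : ∀ v ∈ D.zdArcA, infDist (meshPoint D.δ v) B < m → v ∈ X₂) :
    discreteCrossing R₁ D.δ A₁ B₁ ⊆ slitCrossing hD X₁ X₂ ω₀ n := by
  intro ω hω
  set δ := D.δ with hδ_def
  have hδ : 0 < δ := hD.delta_pos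
  have habs : |δ| = δ := abs_of_pos hδ
  rw [← habs] at hδm H1 H2 H3 H4
  obtain ⟨x, hx, y, hy, ⟨p⟩⟩ := hω
  -- types
  set T₀ : Site 2 → Prop := fun v ↦ infDist (meshPoint δ v) A < m with hT₀
  set T₂ : Site 2 → Prop := fun v ↦ infDist (meshPoint δ v) B < m with hT₂
  -- an arc-`A` site whose mesh point lies in the flower is of one type, and lands in `X₁`/`X₂`
  have hAX : ∀ c ∈ D.zdArcA, (T₀ c → c ∈ X₁) ∧ (T₂ c → c ∈ X₂ ∪ leftBank hD ω₀ n) := fun c hc ↦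
    ⟨fun h ↦ hX₁ c hc h, fun h ↦ Or.inl (hX₂ c hc h)⟩
  -- a site of `Ω_δ`'s boundary with mesh point in the flower is an arc-`A` site
  have hbdA : ∀ c ∈ D.zdBoundary, meshPoint δ c ∈ R₁ → c ∈ D.zdArcA := fun c hc hcR ↦
    (hD.zdBoundary_subset hc).resolve_right fun hB ↦ HB c hB hcR
  -- the classification of an `Ω_δ`-open step that is not a slit step: it is a wired `A`–`A` edge
  have hAA : ∀ {c c' : Site 2}, (openGraph ω ⊓ discreteDomainGraph R₁ δ).Adj c c' →
      (openGraph ω ⊓ discreteDomainGraph D.Ω δ).Adj c c' → ¬ (slitGraph hD ω₀ n ω).Adj c c' →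
      c ∈ D.zdArcA ∧ c' ∈ D.zdArcA := by
    intro c c' h₁ h₂ hns
    obtain ⟨hω', -, -, hcR, hc'R⟩ := step_facts h₁
    obtain ⟨-, hmesh, hcM, hc'M⟩ := open_inf_discreteDomainGraph_adj_iff.1 h₂
    have he : s(c, c') ∈ (discreteDomainGraph D.Ω δ).edgeSet :=
      (SimpleGraph.mem_edgeSet _).2 (discreteDomainGraph_adj_iff.2 ⟨hmesh, hcM, hc'M⟩)
    have hnot : ¬ (D.IsFreeEdge s(c, c') ∧ s(c, c') ∉ revealedFreeEdges hD ω₀ n) := fun h ↦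
      hns (slitGraph_adj.2 ⟨h.1, hω', h.2⟩)
    by_cases hRev : s(c, c') ∈ revealedFreeEdges hD ω₀ n
    · exact (HR _ hRev c (Sym2.mem_mk_left _ _) hcR).elim
    · have hnf : ¬ D.IsFreeEdge s(c, c') := fun hf ↦ hnot ⟨hf, hRev⟩
      by_cases hBc : ∀ z ∈ s(c, c'), z ∉ D.zdArcB
      · have hall : ∀ z ∈ s(c, c'), z ∈ D.zdArcA := by
          by_contra hall
          exact hnf ⟨he, hBc, hall⟩
        exact ⟨hall c (Sym2.mem_mk_left _ _), hall c' (Sym2.mem_mk_right _ _)⟩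
      · exfalso
        simp only [not_forall, not_not, exists_prop] at hBc
        obtain ⟨z, hz, hzB⟩ := hBc
        rcases Sym2.mem_iff.1 hz with rfl | rfl
        · exact HB _ hzB hcR
        · exact HB _ hzB hc'R
  -- the abstract transfer
  have hxR₁ : meshPoint δ x ∈ R₁ :=
    meshDomain_subset_meshVertices _ _ (meshBoundary_subset_meshDomain _ _ hx.1)
  have hyR₁ : meshPoint δ y ∈ R₁ :=
    meshDomain_subset_meshVertices _ _ (meshBoundary_subset_meshDomain _ _ hy.1)
  obtain ⟨hxA, hxΩ⟩ := H1 _ hxR₁ (infDist_le_of_mem_discreteArc hR₁ hx)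
  obtain ⟨hyB, hyΩ⟩ := H2 _ hyR₁ (infDist_le_of_mem_discreteArc hR₁ hy)
  have hxM : x ∉ meshDomain D.Ω δ := fun h ↦ hxΩ (meshDomain_subset_meshVertices _ _ h)
  have hyM : y ∉ meshDomain D.Ω δ := fun h ↦ hyΩ (meshDomain_subset_meshVertices _ _ h)
  obtain ⟨u, hu, w, hw, huw⟩ := exists_reachable_of_walk
    (G₁ := openGraph ω ⊓ discreteDomainGraph R₁ δ) (G := slitGraph hD ω₀ n ω)
    (M := meshDomain D.Ω δ) (X₀ := X₁) (X₂ := X₂ ∪ leftBank hD ω₀ n) (T₀ := T₀) (T₂ := T₂)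
    (fun c c' h ↦ by
      have hadj : (discreteDomainGraph D.Ω δ).Adj c c' := (SimpleGraph.mem_edgeSet _).1 (slitGraph_adj.1 h).1.1
      exact ⟨(discreteDomainGraph_adj_iff.1 hadj).2.1, (discreteDomainGraph_adj_iff.1 hadj).2.2⟩)
    hX₁M
    (fun v h0 h2 ↦ by
      have := H3 _ h0
      have h2' : infDist (meshPoint δ v) B < m := h2
      linarith [abs_nonneg δ])
    (fun c c' h₁ hns ↦ by
      by_cases h₂ : (openGraph ω ⊓ discreteDomainGraph D.Ω δ).Adj c c'
      · -- a wired `A`–`A` edge: both endpoints are arc-`A` sites in the flower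
        obtain ⟨hcA, hc'A⟩ := hAA h₁ h₂ hns
        obtain ⟨-, hzd, -, hcR, hc'R⟩ := step_facts h₁
        exact same_type_of_dist_le H3 (dist_meshPoint_of_adj hzd).le (HA c hcA hcR) (HA c' hc'A hc'R)
      · exact break_type hΩ hδm H3 H4 H5 H6 h₁ h₂)
    (fun c c' h₁ hns hcM ↦ by
      by_cases h₂ : (openGraph ω ⊓ discreteDomainGraph D.Ω δ).Adj c c'
      · exact hAX c (hAA h₁ h₂ hns).1
      · obtain ⟨hA0, hB2⟩ := mem_discreteArc_of_break hΩ hδm H3 H4 h₁ h₂ hcM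
        obtain ⟨-, -, -, hcR, -⟩ := step_facts h₁
        refine ⟨fun h ↦ ?_, fun h ↦ ?_⟩
        · have hc := hA0 h
          exact (hAX c (hbdA c (D.meshBoundary_subset_zdBoundary hc.1) hcR)).1 h
        · have hc := hB2 h
          exact (hAX c (hbdA c (D.meshBoundary_subset_zdBoundary hc.1) hcR)).2 h)
    p (Or.inl ⟨hxA, hxM⟩) hyM hyB
  exact ⟨u, hu, w, hw, huw⟩

end SlitTransfer

/-- **Registered form** (glue `slitTransfer_slitCrossing_of_discreteCrossing` of stmt-CriticalPhenomena-0746): inner flower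
crossings are slit crossings (the lower half of the sandwich for the slit structure). [cite: CamiaNewman2007, Thm 3 and Lemma 7.3] -/
theorem slitTransfer_slitCrossing_of_discreteCrossing : ∀ {D : Literature.Probability.LatticeModels.DiscreteDobrushin} (hD : D.IsZdAdmissible) (ω₀ : Literature.Probability.Percolation.BondConfig (Literature.Probability.LatticeModels.Site 2)) (n : ℕ) (X₁ X₂ : Set (Literature.Probability.LatticeModels.Site 2)) (R₁ A₁ B₁ A B : Set ℂ) (m : ℝ), IsOpen R₁ → IsOpen D.Ω → D.δ < m → (∀ z ∈ R₁, Metric.infDist z A₁ ≤ D.δ → Metric.infDist z A < m ∧ z ∉ D.Ω) → (∀ z ∈ R₁, Metric.infDist z B₁ ≤ D.δ → Metric.infDist z B < m ∧ z ∉ D.Ω) → (∀ z, Metric.infDist z A < m → m + D.δ ≤ Metric.infDist z B) → (∀ f ∈ closure R₁ ∩ frontier D.Ω, (f ∈ A ∧ 2 * D.δ ≤ Metric.infDist f (frontier D.Ω \ A)) ∨ (f ∈ B ∧ 2 * D.δ ≤ Metric.infDist f (frontier D.Ω \ B))) → (∀ z ∈ R₁, z ∉ D.Ω → Metric.infDist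 z A < m ∨ Metric.infDist z B < m) → (∀ v : Literature.Probability.LatticeModels.Site 2, Literature.Probability.LatticeModels.meshPoint D.δ v ∈ R₁ → Literature.Probability.LatticeModels.meshPoint D.δ v ∈ D.Ω → v ∉ Literature.Probability.LatticeModels.meshDomain D.Ω D.δ → Metric.infDist (Literature.Probability.LatticeModels.meshPoint D.δ v) A < m ∨ Metric.infDist (Literature.Probability.LatticeModels.meshPoint D.δ v) B < m) → (∀ v ∈ D.zdArcB, Literature.Probability.LatticeModels.meshPoint D.δ v ∉ R₁) → (∀ v ∈ D.zdArcA, Literature.Probability.LatticeModels.meshPoint D.δ v ∈ R₁ → Metric.infDist (Literature.Probability.LatticeModels.meshPoint D.δ v) A < m ∨ Metric.infDist (Literature.Probability.LatticeModels.meshPoint D.δ v) B < m) → (∀ e ∈ Summit.CriticalPhenomena.CardyFormulaZ2.Cruxes.ParafermionToSLESixFamilies.CaratheodoryNetSlitUniformity.revealedFreeEdges hD ω₀ n, ∀ v ∈ e, Literature.Probability.LatticeModels.meshPoint D.δ v ∉ R₁) → (∀ v ∈ D.zdArcA, Metric.infDist (Literature.Probability.LatticeModels.meshPoint D.δ v)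 A < m → v ∈ X₁) → X₁ ⊆ Literature.Probability.LatticeModels.meshDomain D.Ω D.δ → (∀ v ∈ D.zdArcA, Metric.infDist (Literature.Probability.LatticeModels.meshPoint D.δ v) B < m → v ∈ X₂) → Literature.Probability.Percolation.discreteCrossing R₁ D.δ A₁ B₁ ⊆ EventIdentity.slitCrossing hD X₁ X₂ ω₀ n :=
  fun hD ω₀ n X₁ X₂ R₁ A₁ B₁ A B m ↦ SlitTransfer.slitCrossing_of_discreteCrossing hD ω₀ n X₁ X₂ R₁ A₁ B₁ A B m

end Summit.CriticalPhenomena.CardyFormulaZ2.Cruxes.CardyRigidity.CrossingMartingale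

end
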